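import Literature.Geometry.Riemannian.MeanConvexSubharmonic
import Mathlib.Analysis.InnerProductSpace.Dual

/-!
# The tangent-frame sum of a Hessian: `∑ᵢ D²f(vᵢ, vᵢ) = tr D²f - D²f(∇f, ∇f)/‖∇f‖²`

Topic `Geometry/Riemannian` (fact seat
`provefact-Literature.Geometry.Riemannian.LawsonMichelsohn1984_surrounding`).  Everything here
is **proved**; no definitions.

The mean-convexity clause of `LawsonMichelsohn1984_surrounding` at a regular point `x` of
`{f = 0}` is the positivity of `∑ᵢ D²f(x)(vᵢ, vᵢ)` over orthonormal frames `v` of the tangent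
hyperplane `ker df(x)`.  For explicit defining functions (the bent hypersurfaces of §3) this sum
is best computed as **the trace of the Hessian minus its value on the unit normal**:

* `sum_apply_orthonormal_ker_eq` — for a bilinear form `B` on an `(m + 1)`-dimensional inner
  product space, a nonzero vector `g` and an orthonormal `m`-frame `v` of `g^⊥`:
  `∑ᵢ B(vᵢ, vᵢ) = ∑ⱼ B(bⱼ, bⱼ) - B(g, g)/‖g‖²` (any orthonormal basis `b`);
* `sum_iteratedFDeriv_two_ker_eq` — the same for `B = D²f(x)` and `g = ∇f(x)` (the Riesz vector
  of `df(x) ≠ 0`), frames of `ker df(x)`.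

## References

* H. B. Lawson, Jr., M.-L. Michelsohn, *Embedding and surrounding with positive mean curvature*,
  Invent. Math. 77 (1984), §2 (2.4)–(2.6). [LawsonMichelsohn1984]
-/

noncomputable section

open Set Function Module
open scoped RealInnerProductSpace

namespace Literature.Geometry.Riemannian

variable {E : Type*} [NormedAddCommGroup E] [InnerProductSpace ℝ E] [FiniteDimensional ℝ E]
  {m : ℕ}

/-- The orthogonal complement of `g^⊥` is the line through `g`. [folklore] -/
theorem mem_span_singleton_of_forall_inner_eq_zero (hE : finrank ℝ E = m + 1) {g : E} (hg : g ≠ 0)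
    {v : Fin m → E} (hv : Orthonormal ℝ v) (hvg : ∀ i, ⟪v i, g⟫ = 0) {ν : E}
    (hν : ∀ i, ⟪v i, ν⟫ = 0) : ν ∈ Submodule.span ℝ ({g} : Set E) := by
  -- `span (range v) = (span {g})ᗮ`, by dimension count
  set K : Submodule ℝ E := (Submodule.span ℝ ({g} : Set E))ᗮ with hK
  have hvK : Submodule.span ℝ (Set.range v) ≤ K := by
    rw [Submodule.span_le]
    rintro _ ⟨i, rfl⟩
    show v i ∈ K
    rw [hK, Submodule.mem_orthogonal_singleton_iff_inner_left]
    exact hvg i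
  have hKdim : finrank ℝ K = m := by
    have h1 : finrank ℝ (Submodule.span ℝ ({g} : Set E)) = 1 := finrank_span_singleton hg
    have h2 := Submodule.finrank_add_finrank_orthogonal (Submodule.span ℝ ({g} : Set E))
    rw [h1, hE] at h2
    rw [hK]; omega
  have hvdim : finrank ℝ (Submodule.span ℝ (Set.range v)) = m := by
    rw [finrank_span_eq_card hv.linearIndependent, Fintype.card_fin]
  have heq : Submodule.span ℝ (Set.range v) = K :=
    Submodule.eq_of_le_of_finrank_eq hvK (by rw [hvdim, hKdim])
  -- `ν ⊥ span (range v) = K`, so `ν ∈ Kᗮ = span {g}`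
  have hνK : ν ∈ Kᗮ := by
    rw [← heq, Submodule.mem_orthogonal]
    intro u hu
    refine Submodule.span_induction (p := fun u _ => ⟪u, ν⟫ = 0) ?_ ?_ ?_ ?_ hu
    · rintro _ ⟨i, rfl⟩; exact hν i
    · exact inner_zero_left _
    · intro a b _ _ ha hb; rw [inner_add_left, ha, hb, add_zero]
    · intro c a _ ha; rw [inner_smul_left, ha, mul_zero]
  rwa [hK, Submodule.orthogonal_orthogonal] at hνK

/-- **The tangent-frame sum of a bilinear form**: for `g ≠ 0` in an `(m + 1)`-dimensional inner
product space and an orthonormal `m`-frame `v` of `g^⊥`,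
`∑ᵢ B(vᵢ, vᵢ) = ∑ⱼ B(bⱼ, bⱼ) - B(g, g) / ‖g‖²`. [folklore] -/
theorem sum_apply_orthonormal_ker_eq (hE : finrank ℝ E = m + 1) (B : E →ₗ[ℝ] E →ₗ[ℝ] ℝ)
    {ι : Type*} [Fintype ι] (b : OrthonormalBasis ι ℝ E) {g : E} (hg : g ≠ 0) {v : Fin m → E}
    (hv : Orthonormal ℝ v) (hvg : ∀ i, ⟪v i, g⟫ = 0) :
    ∑ i, B (v i) (v i) = ∑ j, B (b j) (b j) - B g g / ‖g‖ ^ 2 := by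
  obtain ⟨ν, hν, hvν, hsum⟩ := sum_apply_orthonormal_eq_trace_sub hE B b hv
  obtain ⟨c, hc⟩ := Submodule.mem_span_singleton.1
    (mem_span_singleton_of_forall_inner_eq_zero hE hg hv hvg hvν)
  rw [hsum]
  congr 1
  have hc2 : c ^ 2 * ‖g‖ ^ 2 = 1 := by
    have : ‖ν‖ ^ 2 = 1 := by rw [hν, one_pow]
    rw [← hc, norm_smul, mul_pow, Real.norm_eq_abs, sq_abs] at this
    exact this
  have hg2 : ‖g‖ ^ 2 ≠ 0 := pow_ne_zero 2 (norm_ne_zero_iff.2 hg)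
  rw [← hc, map_smul, map_smul, LinearMap.smul_apply, smul_eq_mul, smul_eq_mul,
    eq_div_iff hg2]
  calc c * (c * B g g) * ‖g‖ ^ 2 = (c ^ 2 * ‖g‖ ^ 2) * B g g := by ring
    _ = B g g := by rw [hc2, one_mul]

/-- **The tangent-frame sum of the Hessian at a regular point of a level set**: if
`df(x) ≠ 0` with Riesz vector `∇f(x)` on an `(m + 1)`-dimensional inner product space, then for
every orthonormal `m`-frame `v` of `ker df(x)` and every orthonormal basis `b`,
`∑ᵢ D²f(x)(vᵢ, vᵢ) = ∑ⱼ D²f(x)(bⱼ, bⱼ) - D²f(x)(∇f, ∇f) / ‖∇f‖²`.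
[cite: LawsonMichelsohn1984, §2] -/
theorem sum_iteratedFDeriv_two_ker_eq (hE : finrank ℝ E = m + 1) {f : E → ℝ} {x : E}
    (hf : fderiv ℝ f x ≠ 0) {ι : Type*} [Fintype ι] (b : OrthonormalBasis ι ℝ E)
    {v : Fin m → E} (hv : Orthonormal ℝ v) (hvf : ∀ i, fderiv ℝ f x (v i) = 0) :
    ∑ i, iteratedFDeriv ℝ 2 f x ![v i, v i] =
      ∑ j, iteratedFDeriv ℝ 2 f x ![b j, b j] -
        iteratedFDeriv ℝ 2 f x ![(InnerProductSpace.toDual ℝ E).symm (fderiv ℝ f x),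
          (InnerProductSpace.toDual ℝ E).symm (fderiv ℝ f x)] /
          ‖(InnerProductSpace.toDual ℝ E).symm (fderiv ℝ f x)‖ ^ 2 := by
  set g : E := (InnerProductSpace.toDual ℝ E).symm (fderiv ℝ f x) with hgdef
  have hg : g ≠ 0 := by
    intro h
    apply hf
    have : fderiv ℝ f x = InnerProductSpace.toDual ℝ E g := by
      rw [hgdef, LinearIsometryEquiv.apply_symm_apply]
    rw [this, h, map_zero]
  have hvg : ∀ i, ⟪v i, g⟫ = 0 := fun i => by
    rw [real_inner_comm, hgdef, InnerProductSpace.toDual_symm_apply]; exact hvf i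
  set B : E →ₗ[ℝ] E →ₗ[ℝ] ℝ :=
    (ContinuousLinearMap.coeLM ℝ).comp (fderiv ℝ (fderiv ℝ f) x).toLinearMap with hB
  have hBapp : ∀ a c, B a c = iteratedFDeriv ℝ 2 f x ![a, c] := fun a c => by
    rw [iteratedFDeriv_two_vecCons]; rfl
  have h := sum_apply_orthonormal_ker_eq hE B b hg hv hvg
  simpa only [hBapp] using h

end Literature.Geometry.Riemannian

end
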